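import Summits.QuantumFields.BalabanUV.Beta.GAN24.LegChainPush

/-!
# `BalabanUV.Beta.GAN24.LegChainPushBound` — binder row G-an2-4 ∕ (CONV-C), W-slot, the (α-0) parity re-cut, located crux (Q-L-k₀) (RULING R-gan24p1-g36-1 (5)(C)):
# **THE (H1♮) WINDOW MODULO THE COMPOSITE LEGS' ENVELOPES** — leaf-03's window object `legChain kc K N m (k+1) ∘ bsumPow N (k+1)` on a `LocStencil₂` table
# with bounded slot charges is `LocStencil₂` at rate `κ₀/(18(d+1))` with constant `|Π kc|·|Fib d|·(d+1)²·a_ρ·Jc·L^{d+1}·Zl(κ₀/(2(d+1)))`, `L = N^{k+1}`, AS SOON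
# AS the composite slot legs `Push4Iter.legChain (colH ∘ K) m k` carry sup ∕ unit-gradient envelopes `a, a′` and the composite kernel leg `kChain (krow ∘ K) m k`
# a sup envelope `a_ρ` at blocking `L` (leaf-12's currency) — everything else (carrier, nesting, k-fold iterate, the double-freezing core) is in the tree.

NOT IN PRINT; OUR BOOKKEEPING + PROOF ([folklore]; 0 `def`, 0 cited facts, 0 `def … : Prop`, 0 sorry, 0 wall binders).  HONEST FRAMING (cell contract, verbatim):
«discharging `BetaPertH` makes Bałaban's UV stability UNCONDITIONAL — a real constructive-QFT result; it is NOT the continuum limit and NOT the Clay problem.»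
HONEST DEPENDENCY (verbatim): «continuum YM on T⁴ ⇐ BetaPertH ∧ nine spine estimates (0/9 proved); BetaPertH ⇐ (D1) ∧ (D4) ∧ CAP+tail; G-an2-4 gates asym,
D1 and NE2/3/4.»

## What is proved (generic `d`)
* §1 `vertex2W_bsum` (the double vertex of the block-summed table is the block sum of the double vertex — two finite-sum interchanges), **`bsum_legPush`**
  (`bsum L (legPush l r X s) = legPush l r (bsum L ∘ X) s` for summable bounded slot legs, a summable kernel leg and a bounded table).
* §2 **`legChain_bsumPow_eq_smul_legPush_bsum`** — `legChain kc K N m (k+1) (bsumPow N (k+1) ∘ W) = (∏ kc) • legPush (kChain (krow ∘ K) m k) (legChain (colH ∘ K) m k) (bsum (N^{k+1}) ∘ W)`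
  (leaf-03's `legChain_bsum` + `bsumPow_eq_bsum_pow`, MY `legChain_succ_eq_smul_legPush`, §1) and **`locStencil₂_legChain_bsumPow_of_envelopes`** — THE WINDOW
  MODULO ENVELOPES: `LocStencil₂ (legChain kc K N m (k+1) (bsumPow N (k+1) ∘ W)) (|∏ kc|·|Fib d|·(d+1)²·a_ρ·Jc·(N^{k+1})^{d+1}·Zl(κ₀/(2(d+1)))) (κ₀/3/(6(d+1)))`.
WHAT REMAINS for (H1♮ on 𝒫) at d = 3 (RULING R-gan24p1-g36-1 (4c)(4d)(B), (5)(B)): the three envelope hypotheses for the COMB kernels `K♮ᴱ_j` — slot legs =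
`respStepBmSeq` (`RespStepBmDecompPsi.legChain_colH_coDressKBmAt_KStepUnit` ✓) = `Π_bm ∘ respStep + dz·Psi` ((b1) ✓): leaf-12's envelopes for the UNDRESSED part,
the dressings by parts onto the slot charges (4d) [for the GRADIENT envelope this file asks of the slot legs, the dressed legs do NOT qualify — the by-parts
split is a further file]; kernel leg in the OWNER g36's block-ℓ¹ currency (`DressedLegSawtoothBlockL1` ✓ + `DressedLegBlockL1Envelope` + his 2b twin of the core);
`|∏ kc| ≤ L^{3(d+1)}` under the pin; the arithmetic `θ(k₀) < 1`.  Discharges NOTHING of (Q-L) ∕ (C) ∕ «T2Shape» ∕ «T2Drift» ∕ (hW, hWall); NEVER «G-an2-4 closed»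
as (CONV-C); NOT D1, NOT `BetaPertH`, NOT continuum, NOT Clay; not in print.
Unit `b2b-balaban-gan24-formalise-leaf-01` (G-an2-4 formalisation swarm, leaf prover 01, gen 74), 2026-08-23.
-/

noncomputable section

open Finset
open scoped BigOperators
open Literature.MathematicalPhysics.QuantumFieldTheory.LatticeForm (quo)
open Literature.MathematicalPhysics.QuantumFieldTheory.Balaban1983to89
open Literature.MathematicalPhysics.QuantumFieldTheory.Balaban1983to89.Beta
open B4ContourShift (supNorm)
open B12Sec2to5 (l1 l1_nonneg)
open ExpKernelCalculus (MKer Decays comp Zl Zl_nonneg Zl_pos)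
open OneStepResolventKernel (Fib)
open OneStepKernelFamily (colH)
open AffineAveraging (box toSite)
open BalabanCompositeJets (LocStencil₂ LocStencil₂.nonneg)
open BalabanStepW2 (locStencil₂_smul')
open Summit.QuantumFields.BalabanUV.Beta.GAN24.BiStencilZeroMode (Tab)
open Summit.QuantumFields.BalabanUV.Beta.GAN24.Push4 (legComp vertexW vertexW_apply vertex2W)
open Summit.QuantumFields.BalabanUV.Beta.GAN24.Push4Bounds (LegDecay LegDecay.nonneg LegDecay.abs_le LegDecay.summable legDecay_colH)
open Summit.QuantumFields.BalabanUV.Beta.GAN24.Push4Iter (LegFam legDecay_legChain)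
open Summit.QuantumFields.BalabanUV.Beta.GAN24.Lin4LegTower (bsum bsum_apply bsum_smul)
open Summit.QuantumFields.BalabanUV.Beta.GAN24.Lin4LegTowerUnroll (bsumPow bsumPow_eq_bsum_pow legChain_bsum)
open Summit.QuantumFields.BalabanUV.Beta.GAN24.LegStepPush (krow legPush legPush_inl legPush_inr vertex2W_entry locStencil₂_legPush_bsum)
open Summit.QuantumFields.BalabanUV.Beta.GAN24.LegPushNestAux (abs_vertexW_le_of_bdd summable_of_klegDecay)
open Summit.QuantumFields.BalabanUV.Beta.GAN24.LegChainPush (kChain klegDecay_kChain klegDecay_krow legChain_succ_eq_smul_legPush)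

namespace Summit.QuantumFields.BalabanUV.Beta.GAN24.LegChainPushBound

variable {d : ℕ}

/-! ## §1 The block sum of the position index commutes with the three-leg push -/

/-- [folklore] **THE DOUBLE VERTEX OF THE BLOCK-SUMMED TABLE IS THE BLOCK SUM OF THE DOUBLE VERTEX** (summable slot legs, bounded table):
`vertex2W r (bsum L ∘ X) μ y ν y′ x p f b = Σ_{t ∈ box L} vertex2W r X μ y ν y′ x (L•p + t) f b`. -/
theorem vertex2W_bsum {r : LegFam d} {X : Tab d} {CX : ℝ} (hrs : ∀ μ y κ, Summable fun u => r μ y κ u)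
    (hX : ∀ κ u κ' u' x z a b, |X κ u κ' u' x z a b| ≤ CX) (L : ℕ)
    (μ : Fin (d + 1)) (y : Fin (d + 1) → ℤ) (ν : Fin (d + 1)) (y' : Fin (d + 1) → ℤ) (x p : Fin (d + 1) → ℤ) (f b : Fib d) :
    vertex2W r (fun κ u κ' u' => bsum L (X κ u κ' u')) μ y ν y' x p f b = ∑ t ∈ box (d + 1) L, vertex2W r X μ y ν y' x ((L : ℤ) • p + toSite t) f b := by
  have hsum : ∀ (μ₀ : Fin (d + 1)) (y₀ : Fin (d + 1) → ℤ) (κ₀ : Fin (d + 1)) (F : (Fin (d + 1) → ℤ) → ℝ) (M : ℝ),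
      (∀ u, |F u| ≤ M) → Summable fun u => r μ₀ y₀ κ₀ u * F u := by
    intro μ₀ y₀ κ₀ F M hF
    refine Summable.of_norm_bounded ((hrs μ₀ y₀ κ₀).abs.mul_right M) fun u => ?_
    rw [Real.norm_eq_abs, abs_mul]
    exact mul_le_mul_of_nonneg_left (hF u) (abs_nonneg _)
  simp only [vertex2W_entry, bsum_apply]
  -- inner slot: pull `Σ_t` out of `Σ'_{v'}` and `Σ_{κ₂}`
  have hin : ∀ κ₁ v, (∑ κ₂, ∑' v', r ν y' κ₂ v' * ∑ t ∈ box (d + 1) L, X κ₁ v κ₂ v' x ((L : ℤ) • p + toSite t) f b)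
      = ∑ t ∈ box (d + 1) L, ∑ κ₂, ∑' v', r ν y' κ₂ v' * X κ₁ v κ₂ v' x ((L : ℤ) • p + toSite t) f b := by
    intro κ₁ v
    rw [Finset.sum_comm]
    refine Finset.sum_congr rfl fun κ₂ _ => ?_
    rw [← Summable.tsum_finsetSum (fun t _ => hsum ν y' κ₂ _ CX (fun v' => hX κ₁ v κ₂ v' x _ f b))]
    exact tsum_congr fun v' => by rw [Finset.mul_sum]
  simp_rw [hin]
  -- outer slot: the inner block of sums is bounded uniformly in `v`
  have hbd : ∀ κ₁ v t, |∑ κ₂, ∑' v', r ν y' κ₂ v' * X κ₁ v κ₂ v' x ((L : ℤ) • p + toSite t) f b| ≤ (∑ κ₂, ∑' v', |r ν y' κ₂ v'|) * CX := by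
    intro κ₁ v t
    have h := abs_vertexW_le_of_bdd (r := r) (T := X κ₁ v) hrs (fun lam v' w z f b => hX κ₁ v lam v' w z f b) ν y' x ((L : ℤ) • p + toSite t) f b
    rwa [vertexW_apply] at h
  rw [Finset.sum_comm]
  refine Finset.sum_congr rfl fun κ₁ _ => ?_
  rw [← Summable.tsum_finsetSum (fun t _ => hsum μ y κ₁ _ _ (fun v => hbd κ₁ v t))]
  exact tsum_congr fun v => by rw [Finset.mul_sum]

/-- [folklore] **THE POSITION BLOCK SUM COMMUTES WITH THE THREE-LEG PUSH**: for summable slot legs, a kernel leg with summable slices and a bounded table,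
`bsum L (legPush l r X s) = legPush l r (bsum L ∘ X) s` (leaf-03 g60's `Lin4LegTower.bsum_legStep` for abstract legs). -/
theorem bsum_legPush {l : Fin (d + 1) → (Fin (d + 1) → ℤ) → Fib d → (Fin (d + 1) → ℤ) → ℝ} {r : LegFam d} {X : Tab d} {CX : ℝ}
    (hrs : ∀ μ y κ, Summable fun u => r μ y κ u) (hl : ∀ α x' f, Summable fun x => l α x' f x)
    (hX : ∀ κ u κ' u' x z a b, |X κ u κ' u' x z a b| ≤ CX) (L : ℕ)
    (κ : Fin (d + 1)) (u : Fin (d + 1) → ℤ) (κ' : Fin (d + 1)) (u' : Fin (d + 1) → ℤ) :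
    bsum L (legPush l r X κ u κ' u') = legPush l r (fun κ₁ v κ₂ v' => bsum L (X κ₁ v κ₂ v')) κ u κ' u' := by
  have hCX : 0 ≤ CX := (abs_nonneg _).trans (hX 0 0 0 0 0 0 (Sum.inl 0) (Sum.inl 0))
  funext x' p a b
  rcases a with α | ν
  · rw [bsum_apply, legPush_inl]
    simp only [legPush_inl, vertex2W_bsum hrs hX L, ← Finset.sum_add_distrib, Finset.mul_sum]
    -- `Σ_t Σ'_x Σ_f … = Σ'_x Σ_f Σ_t …`: the kernel leg's slices are summable, the vertices bounded
    have hV : ∀ s₁ s₂ s₃ s₄ w z f b, |vertex2W r X s₁ s₂ s₃ s₄ w z f b| ≤ (∑ κ₂, ∑' v', |r s₁ s₂ κ₂ v'|) * ((∑ κ₂, ∑' v', |r s₃ s₄ κ₂ v'|) * CX) := by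
      intro s₁ s₂ s₃ s₄ w z f b
      exact abs_vertexW_le_of_bdd (r := r) (T := fun κ₁ v => vertexW r (X κ₁ v) s₃ s₄) hrs
        (fun lam v w z f b => abs_vertexW_le_of_bdd (r := r) (T := X lam v) hrs (fun l' v' w z f b => hX lam v l' v' w z f b) s₃ s₄ w z f b) s₁ s₂ w z f b
    have hS : ∀ t ∈ box (d + 1) L, Summable fun x => ∑ f, l α x' f x *
        ((1 / 2 : ℝ) * (vertex2W r X κ u κ' u' x ((L : ℤ) • p + toSite t) f b + vertex2W r X κ' u' κ u x ((L : ℤ) • p + toSite t) f b)) := by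
      intro t _
      refine summable_sum fun f _ => ?_
      set M : ℝ := (1 / 2 : ℝ) * ((∑ κ₂, ∑' v', |r κ u κ₂ v'|) * ((∑ κ₂, ∑' v', |r κ' u' κ₂ v'|) * CX)
        + (∑ κ₂, ∑' v', |r κ' u' κ₂ v'|) * ((∑ κ₂, ∑' v', |r κ u κ₂ v'|) * CX)) with hM
      refine Summable.of_norm_bounded ((hl α x' f).abs.mul_right M) fun x => ?_
      rw [Real.norm_eq_abs, abs_mul]
      refine mul_le_mul_of_nonneg_left ?_ (abs_nonneg _)
      rw [hM, abs_mul, abs_of_pos (by norm_num : (0 : ℝ) < 1 / 2)]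
      exact mul_le_mul_of_nonneg_left ((abs_add_le _ _).trans (add_le_add (hV _ _ _ _ _ _ _ _) (hV _ _ _ _ _ _ _ _))) (by norm_num)
    rw [← Summable.tsum_finsetSum hS]
    refine tsum_congr fun x => ?_
    rw [Finset.sum_comm]
  · simp only [bsum_apply, legPush_inr, Finset.sum_const_zero]

/-! ## §2 The window object as one push, and its `LocStencil₂` bound modulo the composite legs' envelopes -/

section Window

variable {K : ℕ → MKer (d + 1) (Fib d)} {N : ℕ} {kc : ℕ → ℝ} {W : Tab d} {C δ : ℝ}

/-- NOT IN PRINT; OUR BOOKKEEPING.  **leaf-03's WINDOW OBJECT IS ONE THREE-LEG PUSH OF THE BLOCK-SUMMED TABLE THROUGH THE COMPOSITE LEGS**: for kernels `K j` decaying at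
positive rates, `N ≥ 1`, and a `LocStencil₂` table at a positive rate,
`legChain kc K N m (k+1) (bsumPow N (k+1) ∘ W) = (∏_{j<k+1} kc (m+j)) • legPush (kChain (krow ∘ K) m k) (Push4Iter.legChain (colH ∘ K) m k) (bsum (N^{k+1}) ∘ W)`. -/
theorem legChain_bsumPow_eq_smul_legPush_bsum (hN : 1 ≤ N) (hK : ∀ j, ∃ C m : ℝ, 0 < m ∧ Decays (K j) C m) (hW : LocStencil₂ W C δ) (hδ : 0 < δ)
    (m k : ℕ) :
    Lin4LegTowerUnroll.legChain kc K N m (k + 1) (fun κ u κ' u' => bsumPow N (k + 1) (W κ u κ' u'))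
      = (∏ j ∈ Finset.range (k + 1), kc (m + j)) •
          legPush (kChain (fun j => krow (K j) N) m k) (Push4Iter.legChain (fun j => colH (K j) N) m k)
            (fun κ u κ' u' => bsum (N ^ (k + 1)) (W κ u κ' u')) := by
  have hC : 0 ≤ C := hW.nonneg
  have hK' : ∀ n, ∃ δ C : ℝ, 0 < δ ∧ Decays (K n) C δ := fun n => by
    obtain ⟨C, m, hm, h⟩ := hK n; exact ⟨m, C, hm, h⟩
  have hWb : ∃ B : ℝ, ∀ κ u κ' u' x z a b, |W κ u κ' u' x z a b| ≤ B := ⟨C, fun κ u κ' u' x z a b => by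
    refine (hW κ u κ' u' x z a b).trans ?_
    have e1 : Real.exp (-δ * l1 (u' - u)) ≤ 1 := by rw [Real.exp_le_one_iff]; nlinarith [l1_nonneg (u' - u)]
    have e2 : Real.exp (-δ * (l1 (x - u) + l1 (z - u))) ≤ 1 := by
      rw [Real.exp_le_one_iff]; nlinarith [l1_nonneg (x - u), l1_nonneg (z - u)]
    calc C * Real.exp (-δ * l1 (u' - u)) * Real.exp (-δ * (l1 (x - u) + l1 (z - u))) ≤ C * 1 * 1 := by gcongr
      _ = C := by ring⟩
  -- `bsumPow = bsum (N^(k+1))`, then leaf-03's `legChain_bsum`, then the k-fold iterate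
  have e0 : (fun κ u κ' u' => bsumPow N (k + 1) (W κ u κ' u')) = fun κ u κ' u' => bsum (N ^ (k + 1)) (W κ u κ' u') := by
    funext κ u κ' u'; rw [bsumPow_eq_bsum_pow hN]
  rw [e0, legChain_bsum hK' m (k + 1) (N ^ (k + 1)) hWb, legChain_succ_eq_smul_legPush hN hK kc ⟨C, δ, hδ, hW⟩ m k]
  -- the block sum passes the scalar and the push
  obtain ⟨CR, mR, hmR, hR⟩ := legDecay_legChain (l := fun j => colH (K j) N) (N := N)
    (fun j => by obtain ⟨C, m₁, hm₁, h⟩ := hK j; exact ⟨C, m₁, hm₁, legDecay_colH h⟩) m k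
  obtain ⟨CL, mL, hmL, hL⟩ := klegDecay_kChain (l := fun j => krow (K j) N) (N := N)
    (fun j => by obtain ⟨C, m₁, hm₁, h⟩ := hK j; exact ⟨C, m₁, hm₁, fun α x' f x => klegDecay_krow h N α x' f x⟩) m k
  obtain ⟨B, hB⟩ := hWb
  funext κ u κ' u'
  simp only [Pi.smul_apply]
  rw [bsum_smul, bsum_legPush (fun μ y κ₀ => hR.summable hmR μ y κ₀) (summable_of_klegDecay hL hmL) hB]

variable {L : ℕ} {κ₀ a a' aρ g : ℝ}

/-- NOT IN PRINT; OUR PROOF.  **THE (H1♮) WINDOW MODULO THE COMPOSITE LEGS' ENVELOPES.**  Kernels `K j` decaying at positive rates, `N ≥ 1`, a table with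
`LocStencil₂ W C δ` and the three slot-charge rows bounded by `g` (per fibre), and — THE DISPLAYED HYPOTHESES — at blocking `L = N^{k+1}`: the composite slot legs
`R := Push4Iter.legChain (colH ∘ K) m k` with sup envelope `a·e^{−κ₀‖quo L · − y‖∞}` and unit-gradient envelope `a′·…`, the composite kernel leg
`ℓ := kChain (krow ∘ K) m k` with sup envelope `a_ρ·e^{−κ₀‖quo L · − x′‖∞}`; rates `0 < δ`, `0 < κ₀ ≤ (δ/6)·L`.  THEN
`LocStencil₂ (legChain kc K N m (k+1) (bsumPow N (k+1) ∘ W)) (|∏ kc|·|Fib d|·(d+1)²·a_ρ·Jc·L^{d+1}·Zl(κ₀/(2(d+1)))) (κ₀/3/(6(d+1)))`,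
`Jc = (e^{κ₀}Zl(δ/6))·(a′²·C·e^{2κ₀}·M² + 2·a·a′·g·e^{κ₀}·M + a²·g)`, `M = (2/(δ/6))·Zl(δ/12)` — the table's constant meets `a′²`, the slot charges meet `a·a′`, `a²`. -/
theorem locStencil₂_legChain_bsumPow_of_envelopes (hN : 1 ≤ N) (hK : ∀ j, ∃ C m : ℝ, 0 < m ∧ Decays (K j) C m) (hW : LocStencil₂ W C δ) (hδ : 0 < δ)
    (m k : ℕ) (hL : L = N ^ (k + 1)) (hκ : 0 < κ₀) (hgap : κ₀ ≤ δ / 6 * L) (ha : 0 ≤ a) (ha' : 0 ≤ a') (haρ : 0 ≤ aρ) (hg : 0 ≤ g)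
    (hr : ∀ μ y κ v, |Push4Iter.legChain (fun j => colH (K j) N) m k μ y κ v| ≤ a * Real.exp (-(κ₀ * supNorm (quo L v - y))))
    (hr' : ∀ μ y κ v i, |Push4Iter.legChain (fun j => colH (K j) N) m k μ y κ (v + Pi.single i 1) - Push4Iter.legChain (fun j => colH (K j) N) m k μ y κ v|
      ≤ a' * Real.exp (-(κ₀ * supNorm (quo L v - y))))
    (hl : ∀ α x' f x, |kChain (fun j => krow (K j) N) m k α x' f x| ≤ aρ * Real.exp (-(κ₀ * supNorm (quo L x - x'))))
    (hq₂ : ∀ κ₁ v κ₂ x p f b, |∑' v', W κ₁ v κ₂ v' x p f b| ≤ g * Real.exp (-δ * (l1 (x - v) + l1 (p - v))))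
    (hq₁ : ∀ κ₁ κ₂ v' x p f b, |∑' v, W κ₁ v κ₂ v' x p f b| ≤ g * Real.exp (-δ * (l1 (x - v') + l1 (p - v'))))
    (hq₁₂ : ∀ κ₁ κ₂ x p f b, |∑' v, ∑' v', W κ₁ v κ₂ v' x p f b| ≤ g * Real.exp (-δ * l1 (p - x))) :
    LocStencil₂ (Lin4LegTowerUnroll.legChain kc K N m (k + 1) (fun κ u κ' u' => bsumPow N (k + 1) (W κ u κ' u')))
      (|∏ j ∈ Finset.range (k + 1), kc (m + j)| *
        ((Fintype.card (Fib d) : ℝ) * ((d : ℝ) + 1) ^ 2 *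
          (aρ * ((Real.exp κ₀ * Zl (d + 1) (δ / 6)) *
            (a' ^ 2 * C * Real.exp κ₀ ^ 2 * (2 / (δ / 6) * Zl (d + 1) (δ / 6 / 2)) ^ 2
              + 2 * (a * a' * g * Real.exp κ₀ * (2 / (δ / 6) * Zl (d + 1) (δ / 6 / 2))) + a ^ 2 * g)) *
          ((L : ℝ) ^ (d + 1) * Zl (d + 1) (κ₀ / (2 * ((d : ℝ) + 1)))))))
      (κ₀ / 3 / (6 * ((d : ℝ) + 1))) := by
  have hL1 : 1 ≤ L := by rw [hL]; exact Nat.one_le_pow _ _ hN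
  rw [legChain_bsumPow_eq_smul_legPush_bsum hN hK hW hδ m k, ← hL]
  exact locStencil₂_smul' _ (locStencil₂_legPush_bsum hL1 hκ hδ hgap ha ha' haρ hg hr hr' hl hW hq₂ hq₁ hq₁₂)

end Window

end Summit.QuantumFields.BalabanUV.Beta.GAN24.LegChainPushBound

end
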